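import Literature.Computability.QuantumComplexity.PolyCopiesWindow
import Literature.Computability.QuantumComplexity.PolyCopiesExists
import HarnessLib

/-!
# Polynomially many parallel copies, VII: concentration of a general bounded per-copy statistic

Topic `Literature/Computability/QuantumComplexity`; sequel of `PolyCopiesWindow.lean` (the number of copies whose
ANSWER WIRE reads `1` concentrates around `K(n)·μ`) and `PolyCopiesExists.lean` (the one-block marginal of an event
on the measured COPY STRING is `F.kernelProb 0 x GB`). A classical read-out may extract from each copy's measured
block any polynomial-time statistic — an indicator of an event on the copy's output string (e.g. "the query register
spells `σ`"), or a bounded count — and compare the TOTAL over the `K(n)` copies with a threshold (Watrous 2009, §IV.2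
Prop. 3; for real-valued bounded statistics this is the textbook sample-mean estimator, Chebyshev with Popoviciu's
variance bound `B²/4` for values in `[0, B]`). The probabilistic content:

* `PolyCopies.sum_mul_sq_sub_le_of_bounds` — a statistic with values in `[0, B]` has variance `≤ B²/4` under
  probability weights (`Var = E Z² − μ² ≤ Bμ − μ²`);
* **`PolyCopies.kernelProb_ge_of_stat_window`** — for a statistic `Z ∈ [0, B]` of the measured block contents, the
  total `Σ_j Z(block j)` is within `θ·K(n)` of `K(n)·E[Z]` (`E[Z] = Σ_v ‖blockState v‖² Z v`, the one-copy mean) except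
  with probability `≤ B²/(4 K(n) θ²)`;
* **`PolyCopies.kernelProb_ge_of_event_window`** — for an EVENT `GB` on the copy's output string: the number of copies
  whose string lies in `GB` is within `θ·K(n)` of `K(n) · F.kernelProb 0 x GB` except with probability
  `≤ 1/(4 K(n) θ²)`; `…_of_event_threshold_of_le / _of_ge` — the one-sided threshold forms (threshold `t` arbitrary);
* (appended) `PolyCopies.sum_normSq_blockState_mul_eventCount`, **`PolyCopies.kernelProb_ge_of_eventCount_window`** —
  several events `GB t`, `t < m`, per copy (arbitrarily dependent within a copy): the COUNT concentrates around
  `K · Σ_t F.kernelProb 0 x (GB t)` with error `≤ m²/(4Kθ²)` — the read-out shape of a juxtaposed estimator whose one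
  copy carries `m` sub-runs (e.g. one truncated run per oracle gate).

Everything here is PROVED; no definition, no named fact.

## References

* J. Watrous, *Quantum computational complexity*, Springer Encyclopedia 2009 (arXiv:0804.3401), §IV.2 Prop. 3 (proof)
  [Watrous2009].
* S. Arora, B. Barak, *Computational Complexity: A Modern Approach*, CUP 2009, Appendix A Lemma A.12 (Chebyshev)
  [AroraBarak2009].
* M. A. Nielsen, I. L. Chuang, *Quantum Computation and Quantum Information*, CUP 2010, §2.2.8 [NielsenChuang2010].
-/

noncomputable section

namespace Literature.Computability.QuantumComplexity

namespace PolyCopies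

open _root_.Computability Complexity Cryptography Function Matrix Finset

/-! ### Variance of a bounded statistic -/

/-- **Popoviciu-type bound**: under probability weights, a statistic with values in `[0, B]` has variance at most
`B²/4` (`Σ w (Z − μ)² = Σ w Z² − μ² ≤ Bμ − μ² ≤ B²/4`).
[cite: AroraBarak2009, Appendix A (variance bounds for bounded random variables)] -/
theorem sum_mul_sq_sub_le_of_bounds {α : Type*} [Fintype α] (w : α → ℝ) (hw : ∀ a, 0 ≤ w a) (hw1 : ∑ a, w a = 1)
    (Z : α → ℝ) {B : ℝ} (hZ : ∀ a, 0 ≤ Z a ∧ Z a ≤ B) {μ : ℝ} (hμ : ∑ a, w a * Z a = μ) :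
    ∑ a, w a * (Z a - μ) ^ 2 ≤ B ^ 2 / 4 := by
  have h1 : ∑ a, w a * (Z a - μ) ^ 2 = ∑ a, w a * Z a ^ 2 - μ ^ 2 := by
    have e : ∀ a, w a * (Z a - μ) ^ 2 = w a * Z a ^ 2 - 2 * μ * (w a * Z a) + μ ^ 2 * w a := fun a => by ring
    simp only [e, Finset.sum_add_distrib, Finset.sum_sub_distrib, ← Finset.mul_sum, hμ, hw1]
    ring
  have h2 : ∑ a, w a * Z a ^ 2 ≤ B * μ := by
    rw [← hμ, Finset.mul_sum]
    refine Finset.sum_le_sum fun a _ => ?_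
    obtain ⟨h0, hB⟩ := hZ a
    have hwz : 0 ≤ w a * Z a := mul_nonneg (hw a) h0
    calc w a * Z a ^ 2 = (w a * Z a) * Z a := by ring
      _ ≤ (w a * Z a) * B := mul_le_mul_of_nonneg_left hB hwz
      _ = B * (w a * Z a) := by ring
  rw [h1]
  nlinarith [sq_nonneg (μ - B / 2)]

/-! ### Concentration of the total of a bounded per-copy statistic -/

variable {P : Params}

/-- **The total of a bounded per-copy statistic concentrates.** Let `Z` be a real statistic of the measured block
contents with values in `[0, B]`, with one-copy mean `E[Z] = Σ_v ‖blockState v‖² · Z v`, and `θ > 0`. If the read-out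
event `E` contains every measured string of the `K(|x|)`-copy family with `|Σ_j Z(block j) − K·E[Z]| < θ·K`, then the
family outputs a string in `E` with probability `≥ 1 − B²/(4 K(|x|) θ²)` (the blocks are independent with the same
law; Chebyshev for the sample mean). [cite: AroraBarak2009, Appendix A Lemma A.12] [cite: NielsenChuang2010, §2.2.8] -/
theorem kernelProb_ge_of_stat_window (x : List Bool) (Z : QReg (b P x.length) → ℝ) {B : ℝ}
    (hZ : ∀ v, 0 ≤ Z v ∧ Z v ≤ B) {θ : ℝ} (hθ : 0 < θ)
    (E : Set (List Bool)) [DecidablePred (· ∈ E)]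
    (hE : ∀ z : QReg (x.length + anc P x.length),
      |(∑ j : Fin (K P x.length), Z (z ∘ blockEmb P x.length j)) -
          (K P x.length : ℝ) * (∑ v, ‖blockState P x v‖ ^ 2 * Z v)| < θ * K P x.length → List.ofFn z ∈ E) :
    1 - B ^ 2 / (4 * K P x.length * θ ^ 2) ≤ (family P).kernelProb 0 x E := by
  classical
  rw [kernelProb_family_eq]
  set w : QReg (b P x.length) → ℝ := fun v => ‖blockState P x v‖ ^ 2 with hw
  set μ : ℝ := ∑ v, w v * Z v with hμdef
  set fail : (Fin (K P x.length) → QReg (b P x.length)) → Prop :=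
    fun y => θ ≤ |(∑ j, Z (y j)) / (K P x.length : ℕ) - μ| with hfail
  have hKpos : 0 < K P x.length := K_pos (P := P) x.length
  have hKr : (0 : ℝ) < (K P x.length : ℝ) := by exact_mod_cast hKpos
  have hw0 : ∀ v, 0 ≤ w v := fun v => by positivity
  have hw1 : ∑ v, w v = 1 := sum_normSq_blockState x
  have hσ : ∑ v, w v * (Z v - μ) ^ 2 ≤ B ^ 2 / 4 := sum_mul_sq_sub_le_of_bounds w hw0 hw1 Z hZ rfl
  have hcheb := sum_weight_mean_far_le w hw0 hw1 Z rfl hσ hKpos hθ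
  have hpos : (0 : ℝ) < 4 * K P x.length * θ ^ 2 := by positivity
  have hfailSum : (∑ y ∈ univ.filter fail, ∏ j, w (y j)) ≤ B ^ 2 / (4 * K P x.length * θ ^ 2) := by
    refine hcheb.trans (le_of_eq ?_)
    rw [div_div, mul_assoc]
  have htot : (∑ y : Fin (K P x.length) → QReg (b P x.length), ∏ j, w (y j)) = 1 := by
    have e := Finset.prod_univ_sum (fun _ : Fin (K P x.length) => (univ : Finset (QReg (b P x.length))))
      (fun _ v => w v)
    simp only [Fintype.piFinset_univ] at e
    rw [← e, hw1, Finset.prod_const_one]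
  have hterm : ∀ z : QReg (x.length + anc P x.length),
      ‖prodState (blockEmb P x.length) (fun _ => blockState P x) (W1 P x) z‖ ^ 2 *
          (1 - if fail (fun j => z ∘ blockEmb P x.length j) then 1 else 0) ≤
        (if List.ofFn z ∈ E then
          ‖prodState (blockEmb P x.length) (fun _ => blockState P x) (W1 P x) z‖ ^ 2 else 0) := by
    intro z
    by_cases hf : fail (fun j => z ∘ blockEmb P x.length j)
    · rw [if_pos hf, sub_self, mul_zero]
      split_ifs <;> positivity
    · rw [if_neg hf, sub_zero, mul_one, if_pos]
      refine hE z ?_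
      have hf' : |(∑ j : Fin (K P x.length), Z (z ∘ blockEmb P x.length j)) / (K P x.length : ℝ) - μ| < θ := by
        have h := hf
        simp only [hfail, not_le] at h
        exact h
      have e : (∑ j : Fin (K P x.length), Z (z ∘ blockEmb P x.length j)) - (K P x.length : ℝ) * μ =
          (((∑ j : Fin (K P x.length), Z (z ∘ blockEmb P x.length j)) / (K P x.length : ℝ) - μ) *
            (K P x.length : ℝ)) := by
        field_simp
      rw [e, abs_mul, abs_of_pos hKr]
      exact mul_lt_mul_of_pos_right hf' hKr
  calc 1 - B ^ 2 / (4 * K P x.length * θ ^ 2)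
      ≤ 1 - ∑ y ∈ univ.filter fail, ∏ j, w (y j) := by linarith
    _ = ∑ y : Fin (K P x.length) → QReg (b P x.length),
          (∏ j, w (y j)) * (1 - if fail y then 1 else 0) := by
        have e : ∀ y : Fin (K P x.length) → QReg (b P x.length),
            (∏ j, w (y j)) * (1 - if fail y then 1 else 0) =
              (∏ j, w (y j)) - (if fail y then ∏ j, w (y j) else 0) := fun y => by
          split_ifs <;> ring
        simp only [e, Finset.sum_sub_distrib, htot, Finset.sum_filter]
    _ = ∑ z : QReg (x.length + anc P x.length),
          ‖prodState (blockEmb P x.length) (fun _ => blockState P x) (W1 P x) z‖ ^ 2 *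
            (1 - if fail (fun j => z ∘ blockEmb P x.length j) then 1 else 0) :=
        (sum_normSq_prodState_mul blockDisjoint (fun _ => blockState P x) (W1 P x)
          (fun y => 1 - if fail y then 1 else 0)).symm
    _ ≤ _ := Finset.sum_le_sum fun z _ => hterm z

/-! ### Events on the copy's output string -/

/-- **The number of copies whose output string lies in an event concentrates.** For an event `GB` on the measured
string of `F` (read off each block's copy part) and `θ > 0`: if `E` contains every measured string of the
`K(|x|)`-copy family in which the number `S` of blocks whose copy string lies in `GB` satisfies
`|S − K·F.kernelProb 0 x GB| < θ·K`, then the family outputs a string in `E` with probability `≥ 1 − 1/(4K(|x|)θ²)`.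
[cite: Watrous2009, §IV.2 Prop. 3 (proof)] [cite: NielsenChuang2010, §2.2.8] -/
theorem kernelProb_ge_of_event_window (x : List Bool) (GB : Set (List Bool)) [DecidablePred (· ∈ GB)]
    {θ : ℝ} (hθ : 0 < θ) (E : Set (List Bool)) [DecidablePred (· ∈ E)]
    (hE : ∀ z : QReg (x.length + anc P x.length),
      |((univ.filter fun j : Fin (K P x.length) =>
            List.ofFn ((z ∘ blockEmb P x.length j) ∘ Fin.castLEEmb (copy_fits x.length)) ∈ GB).card : ℝ) -
          (K P x.length : ℝ) * P.F.kernelProb 0 x GB| < θ * K P x.length → List.ofFn z ∈ E) :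
    1 - 1 / (4 * K P x.length * θ ^ 2) ≤ (family P).kernelProb 0 x E := by
  classical
  set Z : QReg (b P x.length) → ℝ :=
    fun v => if List.ofFn (v ∘ Fin.castLEEmb (copy_fits x.length)) ∈ GB then 1 else 0 with hZdef
  have hZ : ∀ v, 0 ≤ Z v ∧ Z v ≤ 1 := fun v => by
    simp only [hZdef]; split_ifs <;> norm_num
  have hmean : (∑ v, ‖blockState P x v‖ ^ 2 * Z v) = P.F.kernelProb 0 x GB := by
    rw [← sum_ite_blockState_eq_kernelProb (P := P) x GB]
    refine Finset.sum_congr rfl fun v _ => ?_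
    simp only [hZdef]
    split_ifs <;> simp
  have h := kernelProb_ge_of_stat_window (P := P) x Z hZ hθ E fun z hz => hE z ?_
  · simpa only [one_pow] using h
  · have hcount : (∑ j : Fin (K P x.length), Z (z ∘ blockEmb P x.length j)) =
        ((univ.filter fun j : Fin (K P x.length) =>
          List.ofFn ((z ∘ blockEmb P x.length j) ∘ Fin.castLEEmb (copy_fits x.length)) ∈ GB).card : ℝ) := by
      simp only [hZdef]
      rw [Finset.sum_boole]
    rw [hcount, hmean] at hz
    exact hz

/-- **Threshold read-out of an event count, YES side** (threshold `t` arbitrary, margin `θ`).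
[cite: Watrous2009, §IV.2 Prop. 3 (proof)] -/
theorem kernelProb_ge_of_event_threshold_of_le (x : List Bool) (GB : Set (List Bool)) [DecidablePred (· ∈ GB)]
    {θ t : ℝ} (hθ : 0 < θ) (hx : t + θ ≤ P.F.kernelProb 0 x GB) (E : Set (List Bool)) [DecidablePred (· ∈ E)]
    (hE : ∀ z : QReg (x.length + anc P x.length),
      t * K P x.length ≤ ((univ.filter fun j : Fin (K P x.length) =>
            List.ofFn ((z ∘ blockEmb P x.length j) ∘ Fin.castLEEmb (copy_fits x.length)) ∈ GB).card : ℝ) →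
        List.ofFn z ∈ E) :
    1 - 1 / (4 * K P x.length * θ ^ 2) ≤ (family P).kernelProb 0 x E := by
  refine kernelProb_ge_of_event_window x GB hθ E fun z hz => hE z ?_
  have hK0 : (0 : ℝ) ≤ (K P x.length : ℝ) := Nat.cast_nonneg _
  have h1 := (abs_lt.mp hz).1
  have h2 : (t + θ) * (K P x.length : ℝ) ≤ P.F.kernelProb 0 x GB * (K P x.length : ℝ) :=
    mul_le_mul_of_nonneg_right hx hK0
  nlinarith

/-- **Threshold read-out of an event count, NO side.** [cite: Watrous2009, §IV.2 Prop. 3 (proof)] -/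
theorem kernelProb_ge_of_event_threshold_of_ge (x : List Bool) (GB : Set (List Bool)) [DecidablePred (· ∈ GB)]
    {θ t : ℝ} (hθ : 0 < θ) (hx : P.F.kernelProb 0 x GB ≤ t - θ) (E : Set (List Bool)) [DecidablePred (· ∈ E)]
    (hE : ∀ z : QReg (x.length + anc P x.length),
      ((univ.filter fun j : Fin (K P x.length) =>
            List.ofFn ((z ∘ blockEmb P x.length j) ∘ Fin.castLEEmb (copy_fits x.length)) ∈ GB).card : ℝ) <
          t * K P x.length → List.ofFn z ∈ E) :
    1 - 1 / (4 * K P x.length * θ ^ 2) ≤ (family P).kernelProb 0 x E := by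
  refine kernelProb_ge_of_event_window x GB hθ E fun z hz => hE z ?_
  have hK0 : (0 : ℝ) ≤ (K P x.length : ℝ) := Nat.cast_nonneg _
  have h1 := (abs_lt.mp hz).2
  have h2 : P.F.kernelProb 0 x GB * (K P x.length : ℝ) ≤ (t - θ) * (K P x.length : ℝ) :=
    mul_le_mul_of_nonneg_right hx hK0
  nlinarith


/-! ### Counting several events per copy (appended) -/

/-- **The mean of an event COUNT per copy is the sum of the event probabilities.** For events `GB t`, `t < m`, on the
copy's output string, the one-copy mean of `Z = #{t < m | copy string ∈ GB t}` under the block's Born weights is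
`Σ_{t<m} F.kernelProb 0 x (GB t)` (linearity of expectation; each term by `sum_ite_blockState_eq_kernelProb`).
[cite: NielsenChuang2010, §2.2.8 (measurement of one register)] [cite: AroraBarak2009, Appendix A (linearity of expectation)] -/
theorem sum_normSq_blockState_mul_eventCount (x : List Bool) (m : ℕ) (GB : ℕ → Set (List Bool))
    [∀ t, DecidablePred (· ∈ GB t)] :
    (∑ v : QReg (b P x.length), ‖blockState P x v‖ ^ 2 *
        (((Finset.range m).filter fun t =>
          List.ofFn (v ∘ Fin.castLEEmb (copy_fits x.length)) ∈ GB t).card : ℝ)) =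
      ∑ t ∈ Finset.range m, P.F.kernelProb 0 x (GB t) := by
  classical
  have hcard : ∀ v : QReg (b P x.length),
      (((Finset.range m).filter fun t => List.ofFn (v ∘ Fin.castLEEmb (copy_fits x.length)) ∈ GB t).card : ℝ) =
        ∑ t ∈ Finset.range m, if List.ofFn (v ∘ Fin.castLEEmb (copy_fits x.length)) ∈ GB t then (1 : ℝ) else 0 := by
    intro v
    rw [Finset.sum_boole]
  simp_rw [hcard, Finset.mul_sum, mul_ite, mul_one, mul_zero]
  rw [Finset.sum_comm]
  refine Finset.sum_congr rfl fun t _ => ?_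
  rw [← sum_ite_blockState_eq_kernelProb (P := P) x (GB t)]

/-- **Window for an event count per copy.** With `Z_j = #{t < m | copy string of block j ∈ GB t}` (`0 ≤ Z_j ≤ m`): if `E`
contains every measured string of the `K(|x|)`-copy family with `|Σ_j Z_j − K · Σ_{t<m} F.kernelProb 0 x (GB t)| < θ K`,
then the family outputs a string in `E` with probability `≥ 1 − m²/(4 K(|x|) θ²)`. (The `m` events of one copy may be
arbitrarily dependent; only the copies are independent.) [cite: AroraBarak2009, Appendix A Lemma A.12 (Chebyshev)] -/
theorem kernelProb_ge_of_eventCount_window (x : List Bool) (m : ℕ) (GB : ℕ → Set (List Bool))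
    [∀ t, DecidablePred (· ∈ GB t)] {θ : ℝ} (hθ : 0 < θ) (E : Set (List Bool)) [DecidablePred (· ∈ E)]
    (hE : ∀ z : QReg (x.length + anc P x.length),
      |(∑ j : Fin (K P x.length),
          (((Finset.range m).filter fun t =>
            List.ofFn ((z ∘ blockEmb P x.length j) ∘ Fin.castLEEmb (copy_fits x.length)) ∈ GB t).card : ℝ)) -
          (K P x.length : ℝ) * ∑ t ∈ Finset.range m, P.F.kernelProb 0 x (GB t)| < θ * K P x.length →
        List.ofFn z ∈ E) :
    1 - (m : ℝ) ^ 2 / (4 * K P x.length * θ ^ 2) ≤ (family P).kernelProb 0 x E := by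
  classical
  set Z : QReg (b P x.length) → ℝ := fun v =>
    (((Finset.range m).filter fun t => List.ofFn (v ∘ Fin.castLEEmb (copy_fits x.length)) ∈ GB t).card : ℝ) with hZdef
  have hZ : ∀ v, 0 ≤ Z v ∧ Z v ≤ (m : ℝ) := fun v => by
    refine ⟨by positivity, ?_⟩
    simp only [hZdef]
    exact_mod_cast (Finset.card_filter_le _ _).trans (Finset.card_range m).le
  have hmean : (∑ v, ‖blockState P x v‖ ^ 2 * Z v) = ∑ t ∈ Finset.range m, P.F.kernelProb 0 x (GB t) :=
    sum_normSq_blockState_mul_eventCount (P := P) x m GB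
  have h := kernelProb_ge_of_stat_window (P := P) x Z hZ hθ E fun z hz => hE z (by rw [hmean] at hz; exact hz)
  exact h

end PolyCopies

end Literature.Computability.QuantumComplexity

end
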